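import Summits.QuantumFields.BalabanUV.Beta.FP.MixLoopPowerCounting
import Summits.QuantumFields.BalabanUV.Beta.FP.FarRegionMoment

/-!
# `BalabanUV.Beta.FP.GhostLoopCountingFar` — road «FP» for binder row D1, organisation γ, row **(GH-a) COUNTING** (owner ruling R-FP-28 (d),
# piece list N-d1leaf05g12-1 adopted): the two pieces of the ghost remainder `T^{gh} − Xtr^{gh}` that need NO new letter and NO identity —
# **(g2)** «the FAR WINDOW of the ghost bubble of `T` alone» and **(g3)** «the ULTRA-LOCAL (tadpole-mismatch) pieces» — delivered in the
# WINDOWED-MAJORANT currency (Mκ) of the J-contraction lemma `FP/MixLoopPowerCountingMassQuartic.coarse_secondMoment_of_majorant`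
# ([folklore] lattice bookkeeping on `ℤ⁴`; abstract kernels; every letter a displayed hypothesis; NO road object)

HONEST DEPENDENCY (page 1, mandatory): continuum YM on T⁴ ⇐ BetaPertH ∧ nine spine estimates (0/9 proved); BetaPertH ⇐ (D1) ∧ (D4) ∧
CAP+tail; G-an2-4 gates asym, D1 and NE2/3/4.  HONEST FRAMING (cell contract, verbatim): «discharging `BetaPertH` makes Bałaban's UV
stability UNCONDITIONAL — a real constructive-QFT result; it is NOT the continuum limit and NOT the Clay problem.»  THIS MODULE is elementary
[folklore] real analysis on `ℤ⁴` composed BY NAME from the tree: `FP/MixLoopPowerCounting.sum_exp_le` (the exponential weight's mass, exact power `n⁴`),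
`FP/FarRegionMoment.subset_box_max`∕`sum_box_eq_sum_box_add_sum_annulus` (window + far annulus), the shell engine
`Beta/WindowInterface.tail_sum_le_exp`, `LatticeModels.card_box`.  It asserts nothing about Bałaban's objects, cites nothing, mints no `Prop` fact,
has no `def`, 0 sorry.  NOT (GH-a) (pieces (g1) window mismatch, (g4) scalar constraint loops, (g5) Gram loops are NOT here), NOT `hbook`, NOT D1,
NOT BetaPertH, NOT continuum, NOT Clay.

ABSOLUTE RULE (cell charter, verbatim): «No internally-minted statement may enter as a cited fact. Every hypothesis is either kernel-proved in this
package or a verbatim quotation of a PUBLISHED theorem with page reference. The manuscript(s) under audit are NOT citable for their own disputed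
steps — they are the thing under adjudication; programme-internal (2001/route/tribunal) claims are never citable.»

ROW (road FP OWNER b2b-balaban-beta-d1-p3 gen 8, R-FP-28 (d), CLAIMS.log l.25755; LEAVES-FP «(GH-a) COUNTING … OPEN TO ANY SEAT … claimant posts MINE +
the piece it starts with»; piece list of beta-d1-formalise-leaf-05-g12, NOTE N-d1leaf05g12-1, CLAIMS.log l.25681): the ghost remainder
`T^{gh} − Xtr^{gh} = Σ_i (v ↦ Σ_{b,b′} J b v₀ · J b′ v · k_i(b,b′))` is a sum of five J-contracted fine kernels, «each delivered as `Σ_{v∈S}‖v−v₀‖²|·| ≤ B_i` by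
`coarse_secondMoment_of_majorant` with its windowed-majorant letter (Mκ_i)».  THE (Mκ) CURRENCY (binder `hMκ` of that lemma, VERBATIM):
`Σ_{b∈S} Σ_{b′∈S} e^{−(δ∕(2n))‖b − n•v₀‖∞} · (1 + (‖b′ − b‖∞∕n)²) · κ b b′ ≤ A_κ`   (finite fine window `S`, coarse reference row `v₀`, blocking `n`, J-rate `δ`).
PROVENANCE OF THE PIECES (precision E-d1leaf05g12-1, first-refusal holder beta-d1-formalise-leaf-05-g12, CLAIMS.log l.25859): (g2)∕(g3) are pieces of the
(pp)∕(rem) decomposition OF RECORD = the KKT form `FP/GhostGramJets.hasDerivAt_ghostFirstVar` (with `FP/GhostPairingSplit.scalar_pairing_P0` ∕ `ghost_dictionary`,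
`Γ = G₀ + E`, `E = −𝓘·Q′·G₀`) — NOT the tail of the Schur split `½log det(ιᵀΔ²ι) = log det Δ + ½log det Mid + c`; nothing of that identity is used or restated here.
This file COMPUTES `A_κ` from POINTWISE shapes for two pieces, with `κ := |k|` (so that lemma's `hk` is `le_rfl`):

* **(g2) FAR WINDOW** — BINDING CHECK (R-FP-28 (d), DISPLAYED): `k₂ = 𝟙[‖b−b′‖∞ > n]·½[∇Γ·∇Γ]`; both legs `∇Γ` carry ONE lattice difference EACH and are MASSIVE on
  scale `n` (IR-4 FAR letters, `FP/ConstrainedGhostIR*`), so the pointwise product shape `|k₂(b,b′)| ≤ C‖b′−b‖∞⁻⁶·e^{−(a∕n)‖b′−b‖∞}` beyond the window is the admissible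
  supplier «(Mκ₂) admissible (RHOA-4c ✓ shape)» — no term with two differences on one long-range leg occurs (RISK R-γ-15 does not apply).  Letters (displayed):
  (far-0) `‖b′−b‖∞ ≤ n → k b b′ = 0` (the truncated transport `Xtr^{gh}` lives on the window; this piece is `T` ALONE beyond it);
  (far) `n < ‖b′−b‖∞ → |k b b′| ≤ C·‖b′−b‖∞⁻⁶·e^{−(a∕n)‖b′−b‖∞}` — `FP/FarRegionMoment`'s far shape at `b = 0` (two massive legs: `abs_mul_le_of_legs`, `C = A₁A₂`, `a = 2a′`).
  RESULT **`majorantLetter_far`**: `A_κ = (1 + 480·e^{δ∕4}·(4∕δ)⁴) · (160·C·(1 + 1∕a)) · n²` — the exponential row weight's mass `∝ n⁴` (`sum_exp_recentre_le`) times the far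
  window's `(1+(‖z‖∕n)²)`-weighted mass `≤ 160·C·(1+1∕a)·n⁻²` (**`sum_far_sqWeight_le`**: on the far shells `1 + (‖z‖∕n)² ≤ 2(‖z‖∕n)²`, then `tail_sum_le_exp`).
* **(g3) ULTRA-LOCAL PIECES** — BINDING CHECK (DISPLAYED): `k₃ = [E·Δ̈]`, the vertex `Δ̈` is ultra-local (range `r`, a lattice constant) and the leg `E = Gh − G₀` enters
  UNDIFFERENCED through its NEAR sup letter (IR-4 ✓) — no difference on a long-range leg; «trivial majorant».  Letters: (loc-0) `r < ‖b′−b‖∞ → k b b′ = 0`;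
  (loc) `‖b′−b‖∞ ≤ r → |k b b′| ≤ C_loc`.  RESULT **`majorantLetter_local`**: `A_κ = (1 + 480·e^{δ∕4}·(4∕δ)⁴)·n⁴ · ((2r+1)⁴·(1 + (r∕n)²)·C_loc)` (`card_box`).
The powers of `n` are DISPLAYED, not hidden: the instance values of `C`, `C_loc`, `C_J`, `C_J′` and the units they carry are row RHOA-6e's bookkeeping (as in
`FP/MixLoopPowerCountingMass`); the J-contraction of both pieces (`Σ_{v∈V}‖v−v₀‖∞²·|Σ_{b,b′∈S} J b v₀·J b′ v·k b b′| ≤ 3·C_J·C_J′·(1+16∕δ²)·A_κ`) is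
`coarse_secondMoment_of_majorant` BY NAME at `κ := |k|` (companion `FP/GhostLoopCountingFarContract` on that module's olean).
Provenance: unit `b2b-balaban-t4-ne7b-formalise-leaf-09` (gen 21, cross-cell duty NE7b → road FP), 2026-08-21; «not in print; our bookkeeping»; no existing file touched.
-/

noncomputable section

namespace Summit.QuantumFields.BalabanUV.Beta.FP.GhostLoopCountingFar

open Finset Real
open scoped BigOperators
open Literature.Probability.LatticeModels (box annulus box_mono card_box)
open Literature.MathematicalPhysics.QuantumFieldTheory.Balaban1983to89.Beta.DyadicShell (Pt supNorm mem_box_iff mem_annulus_iff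
  supNorm_eq_of_mem_sphere)
open Literature.MathematicalPhysics.QuantumFieldTheory.Balaban1983to89.Beta.WindowInterface (tail_sum_le_exp)
open Summit.QuantumFields.BalabanUV.Beta.FP.MixLoopPowerCounting (sum_exp_le supNorm_cast_nonneg)
open Summit.QuantumFields.BalabanUV.Beta.FP.FarRegionMoment (subset_box_max sum_box_eq_sum_box_add_sum_annulus)

/-! ## §0 Scalar and lattice helpers -/

/-- [folklore] THE REFERENCE ROW WEIGHT's MASS, RECENTRED: `Σ_{b∈S} e^{−(δ∕(2n))‖b − p‖∞} ≤ (1 + 480·e^{δ∕4}·(4∕δ)⁴)·n⁴` for every finite `S ⊂ ℤ⁴` and centre `p`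
(`MixLoopPowerCounting.sum_exp_le` at rate `δ∕2` after the translation `b ↦ b − p`). -/
theorem sum_exp_recentre_le {δ : ℝ} (hδ : 0 < δ) {n : ℕ} (hn : 1 ≤ n) (S : Finset Pt) (p : Pt) :
    ∑ b ∈ S, Real.exp (-(δ / (2 * n)) * (supNorm (b - p) : ℝ))
      ≤ (1 + 480 * Real.exp (δ / 4) * (4 / δ) ^ 4) * (n : ℝ) ^ 4 := by
  have hδ2 : 0 < δ / 2 := by positivity
  have h := sum_exp_le hδ2 hn (S.image fun b => b - p)
  rw [Finset.sum_image fun x _ y _ hxy => sub_left_injective hxy] at h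
  have e1 : δ / 2 / (n : ℝ) = δ / (2 * n) := by rw [div_div]
  have e2 : δ / 2 / 2 = δ / 4 := by ring
  have e3 : 2 / (δ / 2) = 4 / δ := by
    rw [div_div_eq_mul_div]; ring
  rw [e1, e2, e3] at h
  exact h

/-- [folklore] The n-free majorisation of the shell engine's constant: `80E(1 + n∕a)∕(n+1) ≤ 80E(1 + 1∕a)` (`E ≥ 0`, `a > 0`). -/
theorem tail_const_le_rate {E a : ℝ} (hE : 0 ≤ E) (ha : 0 < a) (n : ℕ) :
    80 * E * (1 + (n : ℝ) / a) / ((n : ℝ) + 1) ≤ 80 * E * (1 + 1 / a) := by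
  have hn1 : (0 : ℝ) < (n : ℝ) + 1 := by positivity
  rw [div_le_iff₀ hn1]
  have hn0 : (0 : ℝ) ≤ n := Nat.cast_nonneg n
  have ha' : 0 ≤ 1 / a := by positivity
  have h1 : 1 + (n : ℝ) / a ≤ (1 + 1 / a) * ((n : ℝ) + 1) := by
    have e : (n : ℝ) / a = (n : ℝ) * (1 / a) := by rw [mul_one_div]
    rw [e]
    nlinarith [mul_nonneg hn0 ha']
  calc 80 * E * (1 + (n : ℝ) / a) ≤ 80 * E * ((1 + 1 / a) * ((n : ℝ) + 1)) :=
        mul_le_mul_of_nonneg_left h1 (by positivity)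
    _ = 80 * E * (1 + 1 / a) * ((n : ℝ) + 1) := by ring

/-- [folklore] **TWO MASSIVE LEGS GIVE THE FAR SHAPE** (scalar form): `|x| ≤ A₁∕s³·e^{−t}`, `|y| ≤ A₂∕s³·e^{−t}` (`A₁ ≥ 0`, `s > 0`) ⟹
`|x·y| ≤ A₁A₂∕s⁶·e^{−2t}` — the product of two leg letters `A(‖z‖∞)⁻³e^{−(a′∕n)‖z‖∞}` is `FarRegionMoment`'s far shape with `C = A₁A₂`, rate `a = 2a′`, `b = 0`. -/
theorem abs_mul_le_of_legs {x y A₁ A₂ s t : ℝ} (hA₁ : 0 ≤ A₁) (hs : 0 < s)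
    (hx : |x| ≤ A₁ / s ^ 3 * Real.exp (-t)) (hy : |y| ≤ A₂ / s ^ 3 * Real.exp (-t)) :
    |x * y| ≤ A₁ * A₂ / s ^ 6 * Real.exp (-(2 * t)) := by
  have hx0 : 0 ≤ A₁ / s ^ 3 * Real.exp (-t) := by positivity
  rw [abs_mul]
  calc |x| * |y| ≤ (A₁ / s ^ 3 * Real.exp (-t)) * (A₂ / s ^ 3 * Real.exp (-t)) :=
        mul_le_mul hx hy (abs_nonneg _) hx0
    _ = A₁ * A₂ / s ^ 6 * (Real.exp (-t) * Real.exp (-t)) := by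
        field_simp
    _ = A₁ * A₂ / s ^ 6 * Real.exp (-(2 * t)) := by
        rw [← Real.exp_add]; congr 1; ring

/-! ## §1 (g2) The far window in (Mκ) currency -/

section Far

variable {k : Pt → Pt → ℝ} {C a δ : ℝ} {n : ℕ}

/-- [folklore] **THE FAR WINDOW's `(1 + (‖z‖∕n)²)`-WEIGHTED MASS, EXACT POWER `n⁻²`**: for every finite `T ⊂ ℤ⁴`,
`Σ_{z∈T, ‖z‖∞>n} (1 + (‖z‖∞∕n)²)·C‖z‖∞⁻⁶·e^{−(a∕n)‖z‖∞} ≤ 160·C·(1 + 1∕a)·n⁻²` (`C ≥ 0`, `a > 0`, `n ≥ 1`):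
on the far shells `‖z‖∞ = r+1 > n` one has `1 + ((r+1)∕n)² ≤ 2((r+1)∕n)²`, so the summand is `≤ (2C∕n²)∕(r+1)⁴·e^{−(a∕n)(r+1)}` — the shell currency of
`WindowInterface.tail_sum_le_exp` with `(E, δ, Lr, M) := (2C∕n², a, n, n)`, whose bound `80E(1 + n∕a)∕(n+1)` is `≤ 160·C·(1+1∕a)∕n²`. -/
theorem sum_far_sqWeight_le (hC : 0 ≤ C) (ha : 0 < a) (hn : 1 ≤ n) (T : Finset Pt) :
    ∑ z ∈ T, (if n < supNorm z then
        (1 + ((supNorm z : ℝ) / n) ^ 2) * (C / (supNorm z : ℝ) ^ 6 * Real.exp (-(a / n) * (supNorm z : ℝ))) else 0)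
      ≤ 160 * C * (1 + 1 / a) / (n : ℝ) ^ 2 := by
  have hn' : (0 : ℝ) < n := by exact_mod_cast hn
  set G : Pt → ℝ := fun z => if n < supNorm z then
      (1 + ((supNorm z : ℝ) / n) ^ 2) * (C / (supNorm z : ℝ) ^ 6 * Real.exp (-(a / n) * (supNorm z : ℝ))) else 0 with hG
  have hG0 : ∀ z, 0 ≤ G z := fun z => by
    simp only [hG]
    split_ifs
    · positivity
    · exact le_rfl
  -- the finite set sits in a ball `box 4 R` containing the window
  set R : ℕ := max n (T.sup supNorm) with hR
  have hnR : n ≤ R := le_max_left _ _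
  have hTR : T ⊆ box 4 R := subset_box_max T n
  have h1 : ∑ z ∈ T, G z ≤ ∑ z ∈ box 4 R, G z := Finset.sum_le_sum_of_subset_of_nonneg hTR fun z _ _ => hG0 z
  -- window + far annulus; `G` vanishes on the window
  rw [sum_box_eq_sum_box_add_sum_annulus G hnR] at h1
  have hnear : ∑ z ∈ box 4 n, G z = 0 := by
    refine Finset.sum_eq_zero fun z hz => ?_
    have hz' : supNorm z ≤ n := mem_box_iff.mp hz
    simp only [hG, if_neg (not_lt.mpr hz')]
  rw [hnear, zero_add] at h1
  -- the shell bound on the far annulus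
  set E : ℝ := 2 * C / (n : ℝ) ^ 2 with hE
  have hE0 : 0 ≤ E := by positivity
  have hshell : ∀ r : ℕ, n ≤ r → ∀ z ∈ annulus 4 r (r + 1),
      |G z| ≤ E / ((r : ℝ) + 1) ^ 4 * Real.exp (-(a / n) * ((r : ℝ) + 1)) := by
    intro r hr z hz
    have hs : supNorm z = r + 1 := supNorm_eq_of_mem_sphere hz
    have hnz : n < supNorm z := by omega
    have hsR : ((supNorm z : ℕ) : ℝ) = (r : ℝ) + 1 := by rw [hs]; push_cast; ring
    have hr1 : (0 : ℝ) < (r : ℝ) + 1 := by positivity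
    rw [abs_of_nonneg (hG0 z)]
    simp only [hG, if_pos hnz, hsR]
    -- `1 + ((r+1)/n)² ≤ 2((r+1)/n)²` since `(r+1)/n ≥ 1`
    have hq : 1 ≤ ((r : ℝ) + 1) / n := by
      rw [le_div_iff₀ hn', one_mul]
      exact_mod_cast (by omega : n ≤ r + 1)
    have hq2 : 1 ≤ (((r : ℝ) + 1) / n) ^ 2 := one_le_pow₀ hq
    have hw : 1 + (((r : ℝ) + 1) / n) ^ 2 ≤ 2 * (((r : ℝ) + 1) / n) ^ 2 := by linarith
    have hrest : 0 ≤ C / ((r : ℝ) + 1) ^ 6 * Real.exp (-(a / n) * ((r : ℝ) + 1)) := by positivity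
    calc (1 + (((r : ℝ) + 1) / n) ^ 2) * (C / ((r : ℝ) + 1) ^ 6 * Real.exp (-(a / n) * ((r : ℝ) + 1)))
        ≤ (2 * (((r : ℝ) + 1) / n) ^ 2) * (C / ((r : ℝ) + 1) ^ 6 * Real.exp (-(a / n) * ((r : ℝ) + 1))) :=
          mul_le_mul_of_nonneg_right hw hrest
      _ = E / ((r : ℝ) + 1) ^ 4 * Real.exp (-(a / n) * ((r : ℝ) + 1)) := by
          simp only [hE]
          field_simp
  have htail := tail_sum_le_exp (K := G) (E := E) (δ := a) (Lr := (n : ℝ)) (M := n) (R := R) hE0 ha hn' hnR hshell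
  have hnn : 0 ≤ ∑ z ∈ annulus 4 n R, G z := Finset.sum_nonneg fun z _ => hG0 z
  rw [abs_of_nonneg hnn] at htail
  have hfin : 80 * E * (1 + (n : ℝ) / a) / ((n : ℝ) + 1) ≤ 160 * C * (1 + 1 / a) / (n : ℝ) ^ 2 := by
    refine (tail_const_le_rate hE0 ha n).trans (le_of_eq ?_)
    simp only [hE]
    field_simp
    ring
  exact h1.trans (htail.trans hfin)

/-- [folklore] **(Mκ₂) — THE FAR WINDOW OF A TWO-MASSIVE-LEG BUBBLE IN (Mκ) CURRENCY.**  Letters: (far-0) `k` vanishes on the window `‖b′−b‖∞ ≤ n`;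
(far) beyond it `|k b b′| ≤ C‖b′−b‖∞⁻⁶·e^{−(a∕n)‖b′−b‖∞}`.  Then for every finite fine window `S` and coarse reference row `v₀`,
`Σ_{b∈S} Σ_{b′∈S} e^{−(δ∕(2n))‖b−n•v₀‖∞}·(1 + (‖b′−b‖∞∕n)²)·|k b b′| ≤ (1 + 480·e^{δ∕4}·(4∕δ)⁴)·(160·C·(1 + 1∕a))·n²`
— the `hMκ` binder of `MixLoopPowerCountingMassQuartic.coarse_secondMoment_of_majorant` at `κ := |k|`, powers of `n` displayed (`n⁴·n⁻²`). -/
theorem majorantLetter_far (hδ : 0 < δ) (hC : 0 ≤ C) (ha : 0 < a) (hn : 1 ≤ n) (S : Finset Pt) (v₀ : Pt)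
    (hk0 : ∀ b b', supNorm (b' - b) ≤ n → k b b' = 0)
    (hkfar : ∀ b b', n < supNorm (b' - b) →
      |k b b'| ≤ C / (supNorm (b' - b) : ℝ) ^ 6 * Real.exp (-(a / n) * (supNorm (b' - b) : ℝ))) :
    ∑ b ∈ S, ∑ b' ∈ S, Real.exp (-(δ / (2 * n)) * (supNorm (b - (n : ℤ) • v₀) : ℝ)) *
        (1 + ((supNorm (b' - b) : ℝ) / n) ^ 2) * |k b b'|
      ≤ (1 + 480 * Real.exp (δ / 4) * (4 / δ) ^ 4) * (160 * C * (1 + 1 / a)) * (n : ℝ) ^ 2 := by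
  have hn' : (0 : ℝ) < n := by exact_mod_cast hn
  set G : Pt → ℝ := fun z => if n < supNorm z then
      (1 + ((supNorm z : ℝ) / n) ^ 2) * (C / (supNorm z : ℝ) ^ 6 * Real.exp (-(a / n) * (supNorm z : ℝ))) else 0 with hG
  set B : ℝ := 160 * C * (1 + 1 / a) / (n : ℝ) ^ 2 with hB
  -- pointwise: the weighted kernel is under the far profile of the separation
  have hpt : ∀ b b', (1 + ((supNorm (b' - b) : ℝ) / n) ^ 2) * |k b b'| ≤ G (b' - b) := by
    intro b b'
    by_cases h : n < supNorm (b' - b)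
    · simp only [hG, if_pos h]
      exact mul_le_mul_of_nonneg_left (hkfar b b' h) (by positivity)
    · simp only [hG, if_neg h, hk0 b b' (not_lt.mp h), abs_zero, mul_zero, le_refl]
  -- inner sum over the running insertion, uniformly in the reference insertion `b`
  have hinner : ∀ b, ∑ b' ∈ S, (1 + ((supNorm (b' - b) : ℝ) / n) ^ 2) * |k b b'| ≤ B := by
    intro b
    calc ∑ b' ∈ S, (1 + ((supNorm (b' - b) : ℝ) / n) ^ 2) * |k b b'| ≤ ∑ b' ∈ S, G (b' - b) := Finset.sum_le_sum fun b' _ => hpt b b'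
      _ = ∑ z ∈ S.image (fun b' => b' - b), G z := by
          rw [Finset.sum_image fun x _ y _ hxy => sub_left_injective hxy]
      _ ≤ B := sum_far_sqWeight_le hC ha hn _
  have hB0 : 0 ≤ B := by positivity
  calc ∑ b ∈ S, ∑ b' ∈ S, Real.exp (-(δ / (2 * n)) * (supNorm (b - (n : ℤ) • v₀) : ℝ)) *
          (1 + ((supNorm (b' - b) : ℝ) / n) ^ 2) * |k b b'|
      = ∑ b ∈ S, Real.exp (-(δ / (2 * n)) * (supNorm (b - (n : ℤ) • v₀) : ℝ)) *
          ∑ b' ∈ S, (1 + ((supNorm (b' - b) : ℝ) / n) ^ 2) * |k b b'| := by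
        refine Finset.sum_congr rfl fun b _ => ?_
        rw [Finset.mul_sum]
        exact Finset.sum_congr rfl fun b' _ => by ring
    _ ≤ ∑ b ∈ S, Real.exp (-(δ / (2 * n)) * (supNorm (b - (n : ℤ) • v₀) : ℝ)) * B :=
        Finset.sum_le_sum fun b _ => mul_le_mul_of_nonneg_left (hinner b) (Real.exp_pos _).le
    _ = (∑ b ∈ S, Real.exp (-(δ / (2 * n)) * (supNorm (b - (n : ℤ) • v₀) : ℝ))) * B := by rw [Finset.sum_mul]
    _ ≤ ((1 + 480 * Real.exp (δ / 4) * (4 / δ) ^ 4) * (n : ℝ) ^ 4) * B :=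
        mul_le_mul_of_nonneg_right (sum_exp_recentre_le hδ hn S _) hB0
    _ = (1 + 480 * Real.exp (δ / 4) * (4 / δ) ^ 4) * (160 * C * (1 + 1 / a)) * (n : ℝ) ^ 2 := by
        simp only [hB]
        field_simp

/-- [folklore] **(Mκ₂), GRADED FAR SHAPE**: the same with `FP/FarRegionMoment`'s full far shape `C‖z‖∞⁻⁶·e^{−(a∕n)‖z‖∞}·(1 + ‖z‖∞∕n)^b` beyond the window
(the polynomial growth graded legs produce is absorbed into half the rate by `FarRegionMoment.poly_exp_le`: `C ↦ C·b!·e^{a∕2}·(2∕a)^b`, `a ↦ a∕2`). -/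
theorem majorantLetter_far_graded {b : ℕ} (hδ : 0 < δ) (hC : 0 ≤ C) (ha : 0 < a) (hn : 1 ≤ n) (S : Finset Pt) (v₀ : Pt)
    (hk0 : ∀ b₁ b', supNorm (b' - b₁) ≤ n → k b₁ b' = 0)
    (hkfar : ∀ b₁ b', n < supNorm (b' - b₁) →
      |k b₁ b'| ≤ C / (supNorm (b' - b₁) : ℝ) ^ 6 *
        (Real.exp (-(a / n) * (supNorm (b' - b₁) : ℝ)) * (1 + (supNorm (b' - b₁) : ℝ) / n) ^ b)) :
    ∑ b₁ ∈ S, ∑ b' ∈ S, Real.exp (-(δ / (2 * n)) * (supNorm (b₁ - (n : ℤ) • v₀) : ℝ)) *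
        (1 + ((supNorm (b' - b₁) : ℝ) / n) ^ 2) * |k b₁ b'|
      ≤ (1 + 480 * Real.exp (δ / 4) * (4 / δ) ^ 4) *
          (160 * (C * ((b.factorial : ℝ) * Real.exp (a / 2) * (2 / a) ^ b)) * (1 + 1 / (a / 2))) * (n : ℝ) ^ 2 := by
  have hn0 : 0 < n := hn
  refine majorantLetter_far hδ (by positivity) (by positivity) hn S v₀ hk0 fun b₁ b' h => (hkfar b₁ b' h).trans ?_
  have hs : 0 ≤ (supNorm (b' - b₁) : ℝ) := supNorm_cast_nonneg _
  have hpe := FarRegionMoment.poly_exp_le b ha hn0 hs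
  rw [mul_comm ((1 + (supNorm (b' - b₁) : ℝ) / n) ^ b)] at hpe
  calc C / (supNorm (b' - b₁) : ℝ) ^ 6 * (Real.exp (-(a / n) * (supNorm (b' - b₁) : ℝ)) * (1 + (supNorm (b' - b₁) : ℝ) / n) ^ b)
      ≤ C / (supNorm (b' - b₁) : ℝ) ^ 6 *
          (((b.factorial : ℝ) * Real.exp (a / 2) * (2 / a) ^ b) * Real.exp (-(a / 2 / n) * (supNorm (b' - b₁) : ℝ))) :=
        mul_le_mul_of_nonneg_left hpe (by positivity)
    _ = C * ((b.factorial : ℝ) * Real.exp (a / 2) * (2 / a) ^ b) / (supNorm (b' - b₁) : ℝ) ^ 6 *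
          Real.exp (-(a / 2 / n) * (supNorm (b' - b₁) : ℝ)) := by ring

/-- [folklore] **(g2) FROM THE TWO LEG LETTERS**: if beyond the window the piece is `c·L₁(b′−b)·L₂(b′−b)` with two far leg letters
`|Lᵢ z| ≤ Aᵢ‖z‖∞⁻³·e^{−(a′∕n)‖z‖∞}` (`‖z‖∞ > n`; both legs MASSIVE on scale `n`, one difference each — the binding check of R-FP-28 (d)) and it vanishes on the
window, then (Mκ₂) holds with `C = |c|·A₁·A₂` and rate `a = 2a′`. -/
theorem majorantLetter_far_of_legs {L₁ L₂ : Pt → ℝ} {A₁ A₂ a' c : ℝ} (hδ : 0 < δ) (hA₁ : 0 ≤ A₁) (hA₂ : 0 ≤ A₂) (ha' : 0 < a') (hn : 1 ≤ n)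
    (S : Finset Pt) (v₀ : Pt)
    (hL₁ : ∀ z : Pt, n < supNorm z → |L₁ z| ≤ A₁ / (supNorm z : ℝ) ^ 3 * Real.exp (-(a' / n) * (supNorm z : ℝ)))
    (hL₂ : ∀ z : Pt, n < supNorm z → |L₂ z| ≤ A₂ / (supNorm z : ℝ) ^ 3 * Real.exp (-(a' / n) * (supNorm z : ℝ)))
    (hk0 : ∀ b b', supNorm (b' - b) ≤ n → k b b' = 0)
    (hkfar : ∀ b b', n < supNorm (b' - b) → k b b' = c * (L₁ (b' - b) * L₂ (b' - b))) :
    ∑ b ∈ S, ∑ b' ∈ S, Real.exp (-(δ / (2 * n)) * (supNorm (b - (n : ℤ) • v₀) : ℝ)) *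
        (1 + ((supNorm (b' - b) : ℝ) / n) ^ 2) * |k b b'|
      ≤ (1 + 480 * Real.exp (δ / 4) * (4 / δ) ^ 4) * (160 * (|c| * A₁ * A₂) * (1 + 1 / (2 * a'))) * (n : ℝ) ^ 2 := by
  refine majorantLetter_far hδ (by positivity) (by positivity) hn S v₀ hk0 fun b b' h => ?_
  have hs : (0 : ℝ) < (supNorm (b' - b) : ℝ) := by
    have : (1 : ℕ) ≤ supNorm (b' - b) := le_trans hn h.le
    exact_mod_cast this
  have hprod := abs_mul_le_of_legs (t := a' / n * (supNorm (b' - b) : ℝ)) hA₁ hs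
    (by simpa [neg_mul] using hL₁ (b' - b) h) (by simpa [neg_mul] using hL₂ (b' - b) h)
  rw [hkfar b b' h, abs_mul]
  calc |c| * |L₁ (b' - b) * L₂ (b' - b)| ≤ |c| * (A₁ * A₂ / (supNorm (b' - b) : ℝ) ^ 6 * Real.exp (-(2 * (a' / n * (supNorm (b' - b) : ℝ))))) :=
        mul_le_mul_of_nonneg_left hprod (abs_nonneg c)
    _ = |c| * A₁ * A₂ / (supNorm (b' - b) : ℝ) ^ 6 * Real.exp (-(2 * a' / n) * (supNorm (b' - b) : ℝ)) := by
        have e : -(2 * (a' / n * (supNorm (b' - b) : ℝ))) = -(2 * a' / n) * (supNorm (b' - b) : ℝ) := by ring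
        rw [e]; ring

end Far

/-! ## §2 (g3) The ultra-local pieces in (Mκ) currency -/

section Local

variable {k : Pt → Pt → ℝ} {C_loc δ : ℝ} {n r : ℕ}

/-- [folklore] **THE LOCAL WINDOW's WEIGHTED COUNT**: for every finite `T ⊂ ℤ⁴`,
`Σ_{z∈T, ‖z‖∞ ≤ r} (1 + (‖z‖∞∕n)²)·C_loc ≤ (2r+1)⁴·(1 + (r∕n)²)·C_loc` (`C_loc ≥ 0`; `card_box`). -/
theorem sum_local_sqWeight_le (hC : 0 ≤ C_loc) (hn : 1 ≤ n) (r : ℕ) (T : Finset Pt) :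
    ∑ z ∈ T, (if supNorm z ≤ r then (1 + ((supNorm z : ℝ) / n) ^ 2) * C_loc else 0)
      ≤ (2 * (r : ℝ) + 1) ^ 4 * ((1 + ((r : ℝ) / n) ^ 2) * C_loc) := by
  have hn' : (0 : ℝ) < n := by exact_mod_cast hn
  rw [← Finset.sum_filter]
  have hsub : T.filter (fun z => supNorm z ≤ r) ⊆ box 4 r := fun z hz => mem_box_iff.mpr (Finset.mem_filter.mp hz).2
  have hpt : ∀ z ∈ T.filter (fun z => supNorm z ≤ r), (1 + ((supNorm z : ℝ) / n) ^ 2) * C_loc ≤ (1 + ((r : ℝ) / n) ^ 2) * C_loc := by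
    intro z hz
    have hzr : (supNorm z : ℝ) ≤ r := by exact_mod_cast (Finset.mem_filter.mp hz).2
    have h0 : 0 ≤ (supNorm z : ℝ) := supNorm_cast_nonneg z
    gcongr
  calc ∑ z ∈ T.filter (fun z => supNorm z ≤ r), (1 + ((supNorm z : ℝ) / n) ^ 2) * C_loc
      ≤ ∑ z ∈ T.filter (fun z => supNorm z ≤ r), (1 + ((r : ℝ) / n) ^ 2) * C_loc := Finset.sum_le_sum hpt
    _ = ((T.filter (fun z => supNorm z ≤ r)).card : ℝ) * ((1 + ((r : ℝ) / n) ^ 2) * C_loc) := by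
        rw [Finset.sum_const, nsmul_eq_mul]
    _ ≤ ((box 4 r).card : ℝ) * ((1 + ((r : ℝ) / n) ^ 2) * C_loc) := by
        gcongr
    _ = (2 * (r : ℝ) + 1) ^ 4 * ((1 + ((r : ℝ) / n) ^ 2) * C_loc) := by
        rw [card_box]; push_cast; ring

/-- [folklore] **(Mκ₃) — AN ULTRA-LOCAL PIECE IN (Mκ) CURRENCY.**  Letters: (loc-0) `k` vanishes beyond range `r` (`r < ‖b′−b‖∞ → k b b′ = 0`);
(loc) `‖b′−b‖∞ ≤ r → |k b b′| ≤ C_loc`.  Then for every finite fine window `S` and coarse reference row `v₀`,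
`Σ_{b∈S} Σ_{b′∈S} e^{−(δ∕(2n))‖b−n•v₀‖∞}·(1 + (‖b′−b‖∞∕n)²)·|k b b′| ≤ (1 + 480·e^{δ∕4}·(4∕δ)⁴)·n⁴·((2r+1)⁴·(1 + (r∕n)²)·C_loc)`
— the `hMκ` binder of `MixLoopPowerCountingMassQuartic.coarse_secondMoment_of_majorant` at `κ := |k|`. -/
theorem majorantLetter_local (hδ : 0 < δ) (hC : 0 ≤ C_loc) (hn : 1 ≤ n) (r : ℕ) (S : Finset Pt) (v₀ : Pt)
    (hk0 : ∀ b b', r < supNorm (b' - b) → k b b' = 0)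
    (hkloc : ∀ b b', supNorm (b' - b) ≤ r → |k b b'| ≤ C_loc) :
    ∑ b ∈ S, ∑ b' ∈ S, Real.exp (-(δ / (2 * n)) * (supNorm (b - (n : ℤ) • v₀) : ℝ)) *
        (1 + ((supNorm (b' - b) : ℝ) / n) ^ 2) * |k b b'|
      ≤ (1 + 480 * Real.exp (δ / 4) * (4 / δ) ^ 4) * (n : ℝ) ^ 4 * ((2 * (r : ℝ) + 1) ^ 4 * ((1 + ((r : ℝ) / n) ^ 2) * C_loc)) := by
  set G : Pt → ℝ := fun z => if supNorm z ≤ r then (1 + ((supNorm z : ℝ) / n) ^ 2) * C_loc else 0 with hG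
  set B : ℝ := (2 * (r : ℝ) + 1) ^ 4 * ((1 + ((r : ℝ) / n) ^ 2) * C_loc) with hB
  have hpt : ∀ b b', (1 + ((supNorm (b' - b) : ℝ) / n) ^ 2) * |k b b'| ≤ G (b' - b) := by
    intro b b'
    by_cases h : supNorm (b' - b) ≤ r
    · simp only [hG, if_pos h]
      exact mul_le_mul_of_nonneg_left (hkloc b b' h) (by positivity)
    · simp only [hG, if_neg h, hk0 b b' (not_le.mp h), abs_zero, mul_zero, le_refl]
  have hinner : ∀ b, ∑ b' ∈ S, (1 + ((supNorm (b' - b) : ℝ) / n) ^ 2) * |k b b'| ≤ B := by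
    intro b
    calc ∑ b' ∈ S, (1 + ((supNorm (b' - b) : ℝ) / n) ^ 2) * |k b b'| ≤ ∑ b' ∈ S, G (b' - b) := Finset.sum_le_sum fun b' _ => hpt b b'
      _ = ∑ z ∈ S.image (fun b' => b' - b), G z := by
          rw [Finset.sum_image fun x _ y _ hxy => sub_left_injective hxy]
      _ ≤ B := sum_local_sqWeight_le hC hn r _
  have hB0 : 0 ≤ B := by positivity
  calc ∑ b ∈ S, ∑ b' ∈ S, Real.exp (-(δ / (2 * n)) * (supNorm (b - (n : ℤ) • v₀) : ℝ)) *
          (1 + ((supNorm (b' - b) : ℝ) / n) ^ 2) * |k b b'|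
      = ∑ b ∈ S, Real.exp (-(δ / (2 * n)) * (supNorm (b - (n : ℤ) • v₀) : ℝ)) *
          ∑ b' ∈ S, (1 + ((supNorm (b' - b) : ℝ) / n) ^ 2) * |k b b'| := by
        refine Finset.sum_congr rfl fun b _ => ?_
        rw [Finset.mul_sum]
        exact Finset.sum_congr rfl fun b' _ => by ring
    _ ≤ ∑ b ∈ S, Real.exp (-(δ / (2 * n)) * (supNorm (b - (n : ℤ) • v₀) : ℝ)) * B :=
        Finset.sum_le_sum fun b _ => mul_le_mul_of_nonneg_left (hinner b) (Real.exp_pos _).le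
    _ = (∑ b ∈ S, Real.exp (-(δ / (2 * n)) * (supNorm (b - (n : ℤ) • v₀) : ℝ))) * B := by rw [Finset.sum_mul]
    _ ≤ ((1 + 480 * Real.exp (δ / 4) * (4 / δ) ^ 4) * (n : ℝ) ^ 4) * B :=
        mul_le_mul_of_nonneg_right (sum_exp_recentre_le hδ hn S _) hB0
    _ = _ := by simp only [hB]

end Local

/-! ## §3 Pieces add in (Mκ) currency -/

/-- [folklore] (Mκ) LETTERS ADD: if `|k₁|` and `|k₂|` obey the windowed-majorant letter with `A₁`, `A₂`, then `|k₁ + k₂|` obeys it with `A₁ + A₂`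
(so the far window (g2) and the ultra-local pieces (g3) may be contracted together or separately). -/
theorem majorantLetter_add {k₁ k₂ : Pt → Pt → ℝ} {w : Pt → ℝ} {W : Pt → Pt → ℝ} {A₁ A₂ : ℝ} (S : Finset Pt)
    (hw : ∀ b, 0 ≤ w b) (hW : ∀ b b', 0 ≤ W b b')
    (h₁ : ∑ b ∈ S, ∑ b' ∈ S, w b * W b b' * |k₁ b b'| ≤ A₁) (h₂ : ∑ b ∈ S, ∑ b' ∈ S, w b * W b b' * |k₂ b b'| ≤ A₂) :
    ∑ b ∈ S, ∑ b' ∈ S, w b * W b b' * |k₁ b b' + k₂ b b'| ≤ A₁ + A₂ := by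
  calc ∑ b ∈ S, ∑ b' ∈ S, w b * W b b' * |k₁ b b' + k₂ b b'|
      ≤ ∑ b ∈ S, ∑ b' ∈ S, (w b * W b b' * |k₁ b b'| + w b * W b b' * |k₂ b b'|) := by
        refine Finset.sum_le_sum fun b _ => Finset.sum_le_sum fun b' _ => ?_
        rw [← mul_add]
        exact mul_le_mul_of_nonneg_left (abs_add_le _ _) (mul_nonneg (hw b) (hW b b'))
    _ = (∑ b ∈ S, ∑ b' ∈ S, w b * W b b' * |k₁ b b'|) + ∑ b ∈ S, ∑ b' ∈ S, w b * W b b' * |k₂ b b'| := by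
        rw [← Finset.sum_add_distrib]
        exact Finset.sum_congr rfl fun b _ => Finset.sum_add_distrib
    _ ≤ A₁ + A₂ := add_le_add h₁ h₂

end Summit.QuantumFields.BalabanUV.Beta.FP.GhostLoopCountingFar

end
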